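import Summits.BirchSwinnertonDyer.Rank1Residual.Additive.RamifiedOrdinaryLineUnique
import HarnessLib

/-!
# Uniqueness of the ramified ordinary line on twist models and on the classes X4♯(G-ord) / X3♯(G-ord);
# the ∃-line form of the δ-input `RamifiedLineKummerEqAt` (cell `b2b-bsdres`, lane CLASS-CLOSURE,
# seat cc-typer-2; team n1011 R5-47 (b): with uniqueness, the ∀-line binder ≡ its ∃-line form)

HONEST FRAMING (cell `b2b-bsdres`, run/shared/lean/b2b/bsd-rank1-residual/, verbatim in every file):
the goal of the cell is to DELETE the COMBINATION-SHAPED residual classes of the Birch–Swinnerton-Dyer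
formula for ALL analytic-rank `≤ 1` elliptic curves over `ℚ` — assembled STRICTLY from published
theorems — so that the rank-`≤ 1` remainder becomes exactly the CONSTRUCTION-SHAPED classes, which are
TYPED (missing-input `Prop`s), NOT attempted. This is not "finishing BSD". Team n1011 / lane
CLASS-CLOSURE: research routes; no claim beyond stated classes; census output = EVIDENCE, never a
Literature fact; RESIDUAL-MAP marks UNCHANGED; nothing is booked by this file. Theorems only: NO
definition, NO named fact, NO conjecture node.

WHAT. `RamifiedOrdinaryLineUnique.eq_of_isRamifiedOrdinaryLine_of_transport` (any sign-equivariant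
`e : V[p^∞] ≃+ W[p^∞]` from a good-ordinary `V`) specialised to the cell's binders:

* §1 `eq_of_isRamifiedOrdinaryLine_of_goodOrd_model_twist` (`W = C • V^{(d)}`, `d ≠ 0`, `V` globally
  minimal, `p ∤ Δ_V`, `p ∤ a_p(V)`; the transport is additive-p1's
  `exists_addEquiv_geomPrimaryTorsion_of_model_twist_sign`), `…_of_goodOrd_pStar_twist` (`d = p*`,
  `GoodOrd V p`), **`ClassX4Gord.eq_of_isRamifiedOrdinaryLine`** (every odd `p`, `p = 3` included) and
  **`ClassX3Gord.eq_of_isRamifiedOrdinaryLine`** (`p` odd) on the `e_E(p) = 2` rows: at the place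
  `v ∋ p`, ANY two ramified ordinary lines `L, L'` of `W` are EQUAL. With p10's existence
  (`ClassX4Gord.exists_isRamifiedOrdinaryLine`, `ClassX3Gord.…`) the ramified ordinary line of these
  rows is a well-defined object `∃!`.
* §2 the δ-input in ∃-form: **`ramifiedLineKummerEqAt_of_exists_of_plus_unique`** — uniqueness of
  `plus` + (for every cyclotomic `κ` and `v ∋ p`) ONE ramified line with the Greenberg = Kummer
  equality at level `ker κ` ⟹ `Additive.RamifiedLineKummerEqAt W p` (the ∀-line binder of
  `CongruentLambdaShiftOfGVTorsionIso.lean`); class forms `ClassX4Gord.ramifiedLineKummerEqAt_of_exists`,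
  `ClassX3Gord.ramifiedLineKummerEqAt_of_exists`, and the twist-model form
  `ramifiedLineKummerEqAt_of_exists_of_goodOrd_pStar_twist` — the literal ∃-statements of team n1011's
  rows T-RD-Δ-K (p05, `≤` half landed, `≥` = F7) / T-RD-M (p07) feed these by `exact`.

References: Greenberg LNM 1716 §2 pp. 63, 69–70 [GreenbergLNM1716]; Greenberg–Vatsal 2000 §2 p. 16,
p. 26 [GreenbergVatsal2000]; Emerton–Pollack–Weston 2006 §3.1 [EmertonPollackWeston2006].
-/

noncomputable section

open scoped Classical NumberField

open NumberField IsDedekindDomain Field WeierstrassCurve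
  Literature.NumberTheory.GaloisRepresentations
  Literature.NumberTheory.EllipticCurves
  Literature.NumberTheory.EllipticCurves.Rank1Residual
  Literature.NumberTheory.EllipticCurves.GreenbergSelmer
  Literature.NumberTheory.EllipticCurves.EmertonPollackWeston2006
  IsDedekindDomain.HeightOneSpectrum
  Summit.BirchSwinnertonDyer.Rank1Residual.X2
  Summit.BirchSwinnertonDyer.Rank1Residual.X2.GreenbergVatsalReductionDatum
  Summit.BirchSwinnertonDyer.Rank1Residual.Additive.RamifiedOrdinaryLineUnique
open WeierstrassCurve (minimalDiscriminantInt integralModelInt)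

universe u

namespace Summit.BirchSwinnertonDyer.Rank1Residual.Additive

/-! ## §1. Twist models and the classes -/

section Models

variable (p : ℕ) [hp : Fact p.Prime] {v : HeightOneSpectrum (𝓞 ℚ)}

/-- **Uniqueness of the ramified ordinary line on a `ℚ`-model of a quadratic twist of a good-ordinary
curve.** `V/ℚ` globally minimal, `p ∤ Δ_V`, `p ∤ a_p(V)`, `v ∋ p`, `d ≠ 0`, `W = C • V^{(d)}`: any two
`L, L'` with `IsRamifiedOrdinaryLine W p _` at `v` are equal (both are the transport of `C_v(V)`).
[cite: GreenbergLNM1716, §2 pp. 63, 69–70] [cite: GreenbergVatsal2000, §2 p. 26] -/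
theorem eq_of_isRamifiedOrdinaryLine_of_goodOrd_model_twist
    (V : WeierstrassCurve ℚ) [V.IsElliptic] [V.IsGloballyMinimal]
    (hpv : ((p : ℕ) : 𝓞 ℚ) ∈ v.asIdeal) (hΔ : ¬ (p : ℤ) ∣ minimalDiscriminantInt V)
    (hord : ¬ (p : ℤ) ∣ V.frobeniusTrace p) {d : ℚ} (hd : d ≠ 0)
    {W : WeierstrassCurve ℚ} (hCW : ∃ C : VariableChange ℚ, C • V.quadraticTwist d = W)
    {L L' : LocalDatum ℚ ↥(W.geomPrimaryTorsion p) v} (hL : IsRamifiedOrdinaryLine W p L)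
    (hL' : IsRamifiedOrdinaryLine W p L') : L = L' := by
  haveI : NeZero (2 : ℚ) := ⟨two_ne_zero⟩
  obtain ⟨e, he, -, -⟩ := exists_addEquiv_geomPrimaryTorsion_of_model_twist_sign p V hd hCW
  exact RamifiedOrdinaryLineUnique.eq_of_isRamifiedOrdinaryLine_of_transport p V hpv hΔ hord e he hL hL'

/-- **The `p*`-twist model form** (`W = C • V^{(p*)}`, `GoodOrd V p`). [cite: GreenbergLNM1716, §2 pp. 63, 69–70] -/
theorem eq_of_isRamifiedOrdinaryLine_of_goodOrd_pStar_twist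
    (V : WeierstrassCurve ℚ) [V.IsElliptic] [V.IsGloballyMinimal] {W : WeierstrassCurve ℚ}
    (hCW : ∃ C : VariableChange ℚ, C • V.quadraticTwist ((-1 : ℚ) ^ (p / 2) * p) = W)
    (hV : GoodOrd V p) (hpv : ((p : ℕ) : 𝓞 ℚ) ∈ v.asIdeal)
    {L L' : LocalDatum ℚ ↥(W.geomPrimaryTorsion p) v} (hL : IsRamifiedOrdinaryLine W p L)
    (hL' : IsRamifiedOrdinaryLine W p L') : L = L' :=
  eq_of_isRamifiedOrdinaryLine_of_goodOrd_model_twist p V hpv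
    (V.not_dvd_minimalDiscriminantInt_of_hasGoodReductionAtPrime' p hV.1) hV.2
    (mul_ne_zero (pow_ne_zero _ (neg_ne_zero.mpr one_ne_zero)) (Nat.cast_ne_zero.mpr hp.out.ne_zero))
    hCW hL hL'

variable {p} {W : WeierstrassCurve ℚ} [W.IsElliptic] [W.IsGloballyMinimal]

/-- **X4♯(G-ord) ∩ `I₀*` (every odd `p`, `p = 3` included): the ramified ordinary line is UNIQUE** — at
the place `v ∋ p` any two `L, L'` with `IsRamifiedOrdinaryLine W p _` coincide (the line of the
good-ordinary twist model `ClassX4Gord.exists_goodOrd_pStar_twist_model`, twisted back; it EXISTS by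
`ClassX4Gord.exists_isRamifiedOrdinaryLine`). X4♯(G-ord) stays CONSTRUCTION-SHAPED; nothing booked.
[cite: GreenbergLNM1716, §2 pp. 63, 69–70] [cite: GreenbergVatsal2000, §2 p. 26] -/
theorem ClassX4Gord.eq_of_isRamifiedOrdinaryLine (hX : ClassX4Gord W p)
    (he : semistabilityIndex W p = 2) (hpv : ((p : ℕ) : 𝓞 ℚ) ∈ v.asIdeal)
    {L L' : LocalDatum ℚ ↥(W.geomPrimaryTorsion p) v} (hL : IsRamifiedOrdinaryLine W p L)
    (hL' : IsRamifiedOrdinaryLine W p L') : L = L' := by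
  obtain ⟨V, _, _, C, hord, hC⟩ := ClassX4Gord.exists_goodOrd_pStar_twist_model W p hX he
  exact eq_of_isRamifiedOrdinaryLine_of_goodOrd_pStar_twist p V ⟨C, hC⟩ hord hpv hL hL'

/-- **X3♯(G-ord) ∩ `I₀*`, `p` odd: the ramified ordinary line is UNIQUE** (same, on
`ClassX3Gord.exists_goodOrd_pStar_twist_model`). X3♯(G-ord) stays as labelled; nothing booked.
[cite: GreenbergLNM1716, §2 pp. 63, 69–70] [cite: GreenbergVatsal2000, §2 p. 26] -/
theorem ClassX3Gord.eq_of_isRamifiedOrdinaryLine (hp2 : p ≠ 2) (hX : ClassX3Gord W p)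
    (he : semistabilityIndex W p = 2) (hpv : ((p : ℕ) : 𝓞 ℚ) ∈ v.asIdeal)
    {L L' : LocalDatum ℚ ↥(W.geomPrimaryTorsion p) v} (hL : IsRamifiedOrdinaryLine W p L)
    (hL' : IsRamifiedOrdinaryLine W p L') : L = L' := by
  obtain ⟨V, _, _, C, hord, hC⟩ := ClassX3Gord.exists_goodOrd_pStar_twist_model W p hp2 hX he
  exact eq_of_isRamifiedOrdinaryLine_of_goodOrd_pStar_twist p V ⟨C, hC⟩ hord hpv hL hL'

end Models

/-! ## §2. The δ-input `RamifiedLineKummerEqAt` from ONE line per `(κ, v)` -/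

section Adapters

variable (W : WeierstrassCurve ℚ) (p : ℕ) [hp : Fact p.Prime]

/-- **∃-form ⟹ ∀-form under uniqueness.** If any two ramified ordinary lines of `W` at a place
`v ∋ p` have the same `plus`, and for every cyclotomic `κ` and `v ∋ p` SOME ramified ordinary line has
`L.greenbergKer (ker κ) = W.localKerOver p (ker κ) ℚ_v`, then `RamifiedLineKummerEqAt W p`.
(team n1011 R5-47 (b): "∀ ≡ ∃" given uniqueness.) [folklore] -/
theorem ramifiedLineKummerEqAt_of_exists_of_plus_unique
    (huniq : ∀ (v : HeightOneSpectrum (𝓞 ℚ)), ((p : ℕ) : 𝓞 ℚ) ∈ v.asIdeal →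
      ∀ (L L' : LocalDatum ℚ (W.geomPrimaryTorsion p) v),
        IsRamifiedOrdinaryLine W p L → IsRamifiedOrdinaryLine W p L' → L.plus = L'.plus)
    (h : ∀ (κ : ZpExtension ℚ p), κ.IsCyclotomic →
      ∀ (v : HeightOneSpectrum (𝓞 ℚ)) (hv : ((p : ℕ) : 𝓞 ℚ) ∈ v.asIdeal),
        ∃ L : LocalDatum ℚ (W.geomPrimaryTorsion p) v, IsRamifiedOrdinaryLine W p L ∧
          L.greenbergKer κ.kerSubgroup = W.localKerOver p κ.kerSubgroup (v.adicCompletion ℚ)) :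
    RamifiedLineKummerEqAt W p := by
  intro κ hκ v hv L hL
  obtain ⟨L₀, hL₀, hL₀eq⟩ := h κ hκ v hv
  rw [LocalDatum.eq_of_plus_eq (huniq v hv L L₀ hL hL₀)]
  exact hL₀eq

variable {W p} [W.IsElliptic] [W.IsGloballyMinimal]

/-- **X4♯(G-ord) ∩ `I₀*`: the δ-input from ONE line per `(κ, v)`** — on the class the uniqueness
hypothesis is the theorem `ClassX4Gord.eq_of_isRamifiedOrdinaryLine`, so the literal ∃-statement of
the kernel rows (T-RD-Δ-K `≤` + F7 `≥`) gives `RamifiedLineKummerEqAt W p`. Nothing booked.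
[cite: GreenbergVatsal2000, §2 p. 16 and p. 26] -/
theorem ClassX4Gord.ramifiedLineKummerEqAt_of_exists (hX : ClassX4Gord W p)
    (he : semistabilityIndex W p = 2)
    (h : ∀ (κ : ZpExtension ℚ p), κ.IsCyclotomic →
      ∀ (v : HeightOneSpectrum (𝓞 ℚ)) (hv : ((p : ℕ) : 𝓞 ℚ) ∈ v.asIdeal),
        ∃ L : LocalDatum ℚ (W.geomPrimaryTorsion p) v, IsRamifiedOrdinaryLine W p L ∧
          L.greenbergKer κ.kerSubgroup = W.localKerOver p κ.kerSubgroup (v.adicCompletion ℚ)) :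
    RamifiedLineKummerEqAt W p :=
  ramifiedLineKummerEqAt_of_exists_of_plus_unique W p
    (fun _ hv _ _ hL hL' ↦ congrArg LocalDatum.plus (hX.eq_of_isRamifiedOrdinaryLine he hv hL hL')) h

/-- **X3♯(G-ord) ∩ `I₀*`, `p` odd: the δ-input from ONE line per `(κ, v)`** (uniqueness =
`ClassX3Gord.eq_of_isRamifiedOrdinaryLine`). Nothing booked. [cite: GreenbergVatsal2000, §2 p. 16 and p. 26] -/
theorem ClassX3Gord.ramifiedLineKummerEqAt_of_exists (hp2 : p ≠ 2) (hX : ClassX3Gord W p)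
    (he : semistabilityIndex W p = 2)
    (h : ∀ (κ : ZpExtension ℚ p), κ.IsCyclotomic →
      ∀ (v : HeightOneSpectrum (𝓞 ℚ)) (hv : ((p : ℕ) : 𝓞 ℚ) ∈ v.asIdeal),
        ∃ L : LocalDatum ℚ (W.geomPrimaryTorsion p) v, IsRamifiedOrdinaryLine W p L ∧
          L.greenbergKer κ.kerSubgroup = W.localKerOver p κ.kerSubgroup (v.adicCompletion ℚ)) :
    RamifiedLineKummerEqAt W p :=
  ramifiedLineKummerEqAt_of_exists_of_plus_unique W p
    (fun _ hv _ _ hL hL' ↦ congrArg LocalDatum.plus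
      (hX.eq_of_isRamifiedOrdinaryLine hp2 he hv hL hL')) h

omit [W.IsElliptic] [W.IsGloballyMinimal] in
/-- **Twist-model form** (`W = C • V^{(p*)}`, `GoodOrd V p` — the shape of team n1011's row T-RD-Δ-K,
whose datum is `twistMap (reductionDatum V …) t`): ONE ramified line with the equality per `(κ, v)` ⟹
`RamifiedLineKummerEqAt W p`. [cite: GreenbergVatsal2000, §2 p. 16 and p. 26] -/
theorem ramifiedLineKummerEqAt_of_exists_of_goodOrd_pStar_twist
    (V : WeierstrassCurve ℚ) [V.IsElliptic] [V.IsGloballyMinimal]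
    (hCW : ∃ C : VariableChange ℚ, C • V.quadraticTwist ((-1 : ℚ) ^ (p / 2) * p) = W)
    (hV : GoodOrd V p)
    (h : ∀ (κ : ZpExtension ℚ p), κ.IsCyclotomic →
      ∀ (v : HeightOneSpectrum (𝓞 ℚ)) (hv : ((p : ℕ) : 𝓞 ℚ) ∈ v.asIdeal),
        ∃ L : LocalDatum ℚ (W.geomPrimaryTorsion p) v, IsRamifiedOrdinaryLine W p L ∧
          L.greenbergKer κ.kerSubgroup = W.localKerOver p κ.kerSubgroup (v.adicCompletion ℚ)) :
    RamifiedLineKummerEqAt W p :=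
  ramifiedLineKummerEqAt_of_exists_of_plus_unique W p
    (fun _ hv _ _ hL hL' ↦ congrArg LocalDatum.plus
      (eq_of_isRamifiedOrdinaryLine_of_goodOrd_pStar_twist p V hCW hV hv hL hL')) h

end Adapters

end Summit.BirchSwinnertonDyer.Rank1Residual.Additive

end
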